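import Summits.QuantumFields.YangMills.Theses.SqueezedSkewness
import Summits.QuantumFields.YangMills.Theses.ThermalDescent
import HarnessLib

/-!
# Routes `SqueezedSkewness` / `ThermalDescent` — direction of strength of the descent bridge

`theorem squeezedSkewness_zeroTemperatureFloors_of_pointlike :
  SqueezedSkewness.PointlikeZeroTemperatureFloors → ThermalDescent.ZeroTemperatureFloors`:
the every-radius cylinder-floor crux of route `SqueezedSkewness` (stmt-QuantumFields-27936, born by the descent-bridge
split of `PointlikeMirrorFloors`, rev 5) implies ThermalDescent's deciding crux `ZeroTemperatureFloors`
(stmt-QuantumFields-25390) — take the bump of radius `ρ = 1/2`; its closed ball around `e₀` is one admissible test function.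
Consequence for staffing: a proof of 27936 closes 25390 by composition with this theorem; a refutation of 25390 refutes 27936.

R3/RECORD framing: an implication between two OPEN cruxes (support glue, `--supports` 25390); neither crux, nor NT (19353),
nor the Yang–Mills mass gap is proved here.
-/

set_option autoImplicit false

namespace Summit.QuantumFields.YangMills.Theorems

open Literature.MathematicalPhysics.QuantumFieldTheory Literature.MathematicalPhysics.QuantumLattice

/-- **Direction of strength of the descent bridge:** `PointlikeZeroTemperatureFloors` (every radius, one unit) implies
ThermalDescent's `ZeroTemperatureFloors` (one test function), with the radius-`1/2` bump as the witness. [folklore] -/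
theorem squeezedSkewness_zeroTemperatureFloors_of_pointlike
    (hZ : Summit.QuantumFields.YangMills.Theses.SqueezedSkewness.PointlikeZeroTemperatureFloors) :
    Summit.QuantumFields.YangMills.Theses.ThermalDescent.ZeroTemperatureFloors := by
  intro G _ _ _ _ hG
  letI : MeasurableSpace G := borel G
  haveI : BorelSpace G := ⟨rfl⟩
  obtain ⟨r, a, ha, ha0, hall⟩ := hZ G hG
  obtain ⟨v, hv0, hball, δ₁, δ₂, ε, β₅, Λ₅, hδ₁, hsupp, hε, hfloor⟩ := hall (1/2) (by norm_num)
  exact ⟨r, a, ha, ha0, v, δ₁, δ₂, ε, β₅, Λ₅, hδ₁, hsupp, hε, hfloor⟩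

end Summit.QuantumFields.YangMills.Theorems
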